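import Literature.AlgebraicGeometry.HodgeTheory.SymmetricA3SliceReduction
import HarnessLib

/-!
# Ordinary double points read off an affine slice: the kernel criterion and the Schur-complement step
# (programme B2-BIF, node checks S6, for the binder hB2 `picardLefschetz_symmetricA3` of crux K1-B)

Family `hodge`, layer `Literature/AlgebraicGeometry/HodgeTheory`, next to `PicardLefschetzNodalForms` (vocabulary
`IsOrdinaryDoublePointOf`: `p ≠ 0`, `∇f(p) = 0`, Hessian of rank `n + 1`), `UniversalHypersurfaceDiscriminantNodeChart`
(`DiscriminantBranches.hessianAt`, Euler `hessianAt_mulVec_self`) and `SymmetricA3SliceReduction` (the `v`-block of the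
Hessian at a symmetric `A₃` point is injective).  Written by the prover seat `hodge-nonav-19716-p2` (g8, cell `hodge-nonav`)
for the node checks of the bifurcation half `IsSymmetricA3Bifurcation` of hB2 (`picardLefschetz_symmetricA3`, crux K1-B of
`Summits/HodgeConjecture/HodgeConjecture/Theses/SignSymmetricPowers.lean`, stmt-HodgeConjecture-19716): after the
non-degenerate directions `v` have been eliminated (AGZV II §5.2; Voisin II §2.1.1 Lemma 2.7), a critical point of the
member `F` at a chart point `x(u*)` is an ORDINARY DOUBLE POINT iff the second `u`-derivative of the reduced function —
the SCHUR COMPLEMENT of the `v`-block in the affine Hessian — is non-zero.  This file proves the two linear-algebra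
steps of that statement, for an arbitrary form:

* `isOrdinaryDoublePointOf_of_slice_injective` — for `F` homogeneous of degree `d`, `p_j ≠ 0`, `∇F(p) = 0`: if the
  Hessian `Hess(F)(p)` kills no non-zero vector of the slice `{z_j = 0}`, then `p` is an ordinary double point (the kernel
  is the line `ℂp` by Euler, so the rank is `n + 1` by rank–nullity) — the converse of
  `IsOrdinaryDoublePointOf.eq_zero_of_hessian_mulVec_eq_zero` of `NodalFormPencilNonsingular`;
* `slice_injective_of_schur` — SCHUR STEP for any square matrix `M` and indices `j ≠ k`: if the block of rows AND
  columns `∉ {j, k}` is injective (no non-zero `z` with `z_j = z_k = 0` has all rows `i ∉ {j,k}` of `Mz` zero), and `w`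
  with `w_j = 0`, `w_k = 1` solves the rows `i ∉ {j,k}` with `(Mw)_k ≠ 0`, then `M` kills no non-zero vector of
  `{z_j = 0}` (in the application `w = ∂ᵤx(u*)` and `(Mw)_k = ∂ᵤh(u*)`, the derivative of the reduced `∂ₖ`-partial);
* `isOrdinaryDoublePointOf_of_schur` — the two combined;
* `block_injective_iff_det_ne_zero` — the block-injectivity hypothesis is `det ≠ 0` of the square sub-matrix on the
  indices `∉ {j, k}` (so it is an OPEN condition in the entries), and `IsSymmetricA3Datum.det_block_hessianAt_ne_zero` —
  it holds for `Hess(f₁)(e_j)` at a symmetric `A₃` point (`IsSymmetricA3Datum.eq_zero_of_hessianAt_mulVec_eq_zero`).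

## References
* [VoisinHodgeII2003] C. Voisin, *Hodge Theory and Complex Algebraic Geometry II*, CUP 2003, §2.1.1 (Lemma 2.7,
  Cor. 2.8: the Hessian of the local equation at an ordinary double point), §2.3.1.
* [ArnoldGuseinzadeVarchenko2012] AGZV II, Part I §5.2 (the `B₂` point: nodes of the members `λ₂ = 0` and
  `λ₁² = 4λ₂` after elimination of the non-degenerate variables).
-/

noncomputable section

open MvPolynomial

namespace Literature.AlgebraicGeometry.HodgeTheory

open DiscriminantBranches

section HodgeTheory

variable {n d : ℕ}

/-! ### The kernel criterion: Hessian injective on the slice `{z_j = 0}` ⟹ ordinary double point -/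

/-- **Ordinary double point from slice injectivity.**  Let `F` be homogeneous of degree `d`, `p_j ≠ 0`, and
`∇F(p) = 0`.  If `Hess(F)(p) z = 0` with `z_j = 0` forces `z = 0`, then `p` is an ordinary double point of `F`:
by Euler `Hess(F)(p) p = (d-1)∇F(p) = 0`, so the kernel is exactly the line `ℂ p` and the rank is `n + 1`.
(Converse direction of `IsOrdinaryDoublePointOf.eq_zero_of_hessian_mulVec_eq_zero`.)
[cite: VoisinHodgeII2003, §2.1.1 Cor. 2.8 and §2.3.1 (ordinary double points)] -/
theorem isOrdinaryDoublePointOf_of_slice_injective {F : MvPolynomial (Fin (n + 2)) ℂ} {p : Fin (n + 2) → ℂ}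
    {j : Fin (n + 2)} (hF : F.IsHomogeneous d) (hpj : p j ≠ 0) (hgrad : ∀ i, eval p (pderiv i F) = 0)
    (hinj : ∀ z : Fin (n + 2) → ℂ, z j = 0 → (hessianAt F p).mulVec z = 0 → z = 0) :
    IsOrdinaryDoublePointOf F p := by
  classical
  have hp0 : p ≠ 0 := fun h => hpj (by rw [h]; rfl)
  refine ⟨hp0, hgrad, ?_⟩
  have hself : (hessianAt F p).mulVec p = 0 := hessianAt_mulVec_self hF hgrad
  have hker : LinearMap.ker (hessianAt F p).mulVecLin = Submodule.span ℂ {p} := by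
    apply le_antisymm
    · intro z hz
      rw [LinearMap.mem_ker, Matrix.mulVecLin_apply] at hz
      rw [Submodule.mem_span_singleton]
      refine ⟨z j / p j, ?_⟩
      have h0 : z - (z j / p j) • p = 0 := by
        refine hinj _ ?_ ?_
        · simp [div_mul_cancel₀ _ hpj]
        · rw [Matrix.mulVec_sub, Matrix.mulVec_smul, hz, hself, smul_zero, sub_zero]
      rw [sub_eq_zero] at h0
      exact h0.symm
    · rw [Submodule.span_le, Set.singleton_subset_iff, SetLike.mem_coe, LinearMap.mem_ker, Matrix.mulVecLin_apply]
      exact hself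
  have hfin : Module.finrank ℂ (LinearMap.ker (hessianAt F p).mulVecLin) = 1 := by
    rw [hker, finrank_span_singleton hp0]
  have hsum := LinearMap.finrank_range_add_finrank_ker (hessianAt F p).mulVecLin
  rw [hfin, Module.finrank_fintype_fun_eq_card, Fintype.card_fin] at hsum
  show Module.finrank ℂ (LinearMap.range (hessianAt F p).mulVecLin) = n + 1
  omega

/-! ### The Schur-complement step -/

/-- **Schur step.**  For a square matrix `M` and `j ≠ k`: if no non-zero `z` with `z_j = z_k = 0` has all rows
`i ∉ {j, k}` of `Mz` equal to zero (the `(∉{j,k}) × (∉{j,k})`-block is injective), and some `w` with `w_j = 0`,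
`w_k = 1` has the rows `i ∉ {j,k}` of `Mw` zero and `(Mw)_k ≠ 0` (the Schur complement of the block), then `M`
kills no non-zero `z` with `z_j = 0`.  (Elimination: `z - z_k • w` lies in the block's kernel, so `z = z_k • w`, and
row `k` gives `z_k (Mw)_k = 0`.)  [cite: VoisinHodgeII2003, §2.1.1 Lemma 2.7 (elimination of the non-degenerate variables)] -/
theorem slice_injective_of_schur {ι R : Type*} [Fintype ι] [DecidableEq ι] [Field R] {M : Matrix ι ι R} {j k : ι}
    (hblock : ∀ z : ι → R, z j = 0 → z k = 0 → (∀ i, i ≠ j → i ≠ k → M.mulVec z i = 0) → z = 0)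
    {w : ι → R} (hwj : w j = 0) (hwk : w k = 1) (hw : ∀ i, i ≠ j → i ≠ k → M.mulVec w i = 0)
    (hschur : M.mulVec w k ≠ 0) :
    ∀ z : ι → R, z j = 0 → M.mulVec z = 0 → z = 0 := by
  intro z hzj hz
  have h0 : z - z k • w = 0 := by
    refine hblock _ ?_ ?_ ?_
    · simp [hzj, hwj]
    · simp [hwk]
    · intro i hij hik
      rw [Matrix.mulVec_sub, Matrix.mulVec_smul, Pi.sub_apply, Pi.smul_apply, hz, hw i hij hik, Pi.zero_apply,
        smul_zero, sub_zero]
  rw [sub_eq_zero] at h0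
  have ht : z k = 0 := by
    have h1 := congr_fun hz k
    rw [h0, Matrix.mulVec_smul, Pi.smul_apply, Pi.zero_apply, smul_eq_mul] at h1
    exact (mul_eq_zero.1 h1).resolve_right hschur
  rw [h0, ht, zero_smul]

/-- **Ordinary double point by the Schur step**: `F` homogeneous of degree `d`, `p_j ≠ 0`, `∇F(p) = 0`, the
`(∉{j,k})`-block of `Hess(F)(p)` injective, and a slice vector `w` (`w_j = 0`, `w_k = 1`) solving the rows `∉ {j,k}`
with non-zero Schur complement `(Hess(F)(p) w)_k` ⟹ `IsOrdinaryDoublePointOf F p`.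
[cite: VoisinHodgeII2003, §2.1.1 Lemma 2.7, Cor. 2.8] [cite: ArnoldGuseinzadeVarchenko2012, Part I §5.2] -/
theorem isOrdinaryDoublePointOf_of_schur {F : MvPolynomial (Fin (n + 2)) ℂ} {p : Fin (n + 2) → ℂ}
    {j k : Fin (n + 2)} (hF : F.IsHomogeneous d) (hpj : p j ≠ 0) (hgrad : ∀ i, eval p (pderiv i F) = 0)
    (hblock : ∀ z : Fin (n + 2) → ℂ, z j = 0 → z k = 0 →
      (∀ i, i ≠ j → i ≠ k → (hessianAt F p).mulVec z i = 0) → z = 0)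
    {w : Fin (n + 2) → ℂ} (hwj : w j = 0) (hwk : w k = 1)
    (hw : ∀ i, i ≠ j → i ≠ k → (hessianAt F p).mulVec w i = 0) (hschur : (hessianAt F p).mulVec w k ≠ 0) :
    IsOrdinaryDoublePointOf F p := by
  classical
  exact isOrdinaryDoublePointOf_of_slice_injective hF hpj hgrad (slice_injective_of_schur hblock hwj hwk hw hschur)

/-! ### Block injectivity is `det ≠ 0` of the square sub-matrix (an open condition) -/

/-- **Block injectivity ⟺ the square sub-matrix on the indices `∉ {j,k}` has non-zero determinant.**  (Extend a
kernel vector of the sub-matrix by zero at `j, k`; restrict a slice vector with `z_j = z_k = 0`.)  In particular the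
block-injectivity hypothesis of `slice_injective_of_schur` is an OPEN condition in the entries of `M`.
[cite: VoisinHodgeII2003, §2.1.1 Lemma 2.7] -/
theorem block_injective_iff_det_ne_zero {R : Type*} [Field R] (M : Matrix (Fin (n + 2)) (Fin (n + 2)) R)
    (j k : Fin (n + 2)) :
    (∀ z : Fin (n + 2) → R, z j = 0 → z k = 0 → (∀ i, i ≠ j → i ≠ k → M.mulVec z i = 0) → z = 0) ↔
      (M.submatrix (fun i : {i : Fin (n + 2) // i ≠ j ∧ i ≠ k} => i.1)
        (fun i : {i : Fin (n + 2) // i ≠ j ∧ i ≠ k} => i.1)).det ≠ 0 := by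
  classical
  set I := {i : Fin (n + 2) // i ≠ j ∧ i ≠ k}
  set N : Matrix I I R := M.submatrix (fun i : I => i.1) (fun i : I => i.1) with hN
  -- extension by zero and its properties
  let ext : (I → R) → (Fin (n + 2) → R) := fun v i => if h : i ≠ j ∧ i ≠ k then v ⟨i, h⟩ else 0
  have hext_apply : ∀ (v : I → R) (i : I), ext v i.1 = v i := fun v i => by
    simp only [ext, dif_pos i.2, Subtype.coe_eta]
  have hext_j : ∀ v, ext v j = 0 := fun v => by simp [ext]
  have hext_k : ∀ v, ext v k = 0 := fun v => by simp [ext]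
  have hsum : ∀ (g : Fin (n + 2) → R) (v : I → R), ∑ i, g i * ext v i = ∑ i : I, g i.1 * v i := by
    intro g v
    have h1 : ∑ i ∈ Finset.univ.filter (fun i : Fin (n + 2) => i ≠ j ∧ i ≠ k), g i * ext v i =
        ∑ i : I, g i.1 * ext v i.1 :=
      Finset.sum_subtype (p := fun i : Fin (n + 2) => i ≠ j ∧ i ≠ k) _ (fun x => by simp) (fun i => g i * ext v i)
    have h2 : ∑ i ∈ Finset.univ.filter (fun i : Fin (n + 2) => i ≠ j ∧ i ≠ k), g i * ext v i = ∑ i, g i * ext v i := by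
      refine Finset.sum_subset (Finset.filter_subset _ _) fun i _ hi => ?_
      have : ¬ (i ≠ j ∧ i ≠ k) := by simpa using hi
      simp only [ext, dif_neg this, mul_zero]
    rw [← h2, h1]
    exact Finset.sum_congr rfl fun i _ => by rw [hext_apply]
  have hmul : ∀ (v : I → R) (i : I), M.mulVec (ext v) i.1 = N.mulVec v i := by
    intro v i
    rw [Matrix.mulVec, dotProduct, hsum, Matrix.mulVec, dotProduct]
    rfl
  constructor
  · intro h hdet
    obtain ⟨v, hv0, hv⟩ := Matrix.exists_mulVec_eq_zero_iff.2 hdet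
    apply hv0
    have hz : ext v = 0 := h (ext v) (hext_j v) (hext_k v) fun i hij hik => by
      rw [hmul v ⟨i, hij, hik⟩, hv, Pi.zero_apply]
    funext i
    rw [← hext_apply v i, hz, Pi.zero_apply, Pi.zero_apply]
  · intro hdet z hzj hzk hz
    let v : I → R := fun i => z i.1
    have hzext : ext v = z := by
      funext i
      by_cases h : i ≠ j ∧ i ≠ k
      · simp only [ext, dif_pos h, v]
      · rw [not_and_or, not_not, not_not] at h
        simp only [ext]
        rw [dif_neg (by tauto)]
        rcases h with rfl | rfl
        · exact hzj.symm
        · exact hzk.symm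
    have hNv : N.mulVec v = 0 := by
      funext i
      rw [← hmul, hzext, hz i.1 i.2.1 i.2.2, Pi.zero_apply]
    have hv : v = 0 := by
      by_contra hv
      exact hdet (Matrix.exists_mulVec_eq_zero_iff.1 ⟨v, hv, hNv⟩)
    rw [← hzext, hv]
    funext i
    simp [ext]

/-- **At a symmetric `A₃` point the `(∉{j,k})`-block of `Hess(f₁)(e_j)` has non-zero determinant**
(`IsSymmetricA3Datum.eq_zero_of_hessianAt_mulVec_eq_zero`: the block is injective).
[cite: ArnoldGuseinzadeVarchenko2012, Part I §5.2] [cite: VoisinHodgeII2003, §2.1.1 Lemma 2.7] -/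
theorem IsSymmetricA3Datum.det_block_hessianAt_ne_zero {f₁ g₀ g₂ : MvPolynomial (Fin (n + 2)) ℂ}
    {j k : Fin (n + 2)} {a : Fin (n + 2) → ℂˣ} (hf₁ : f₁.IsHomogeneous d) (hD : IsSymmetricA3Datum f₁ g₀ g₂ j k a) :
    ((hessianAt f₁ (Pi.single j 1)).submatrix (fun i : {i : Fin (n + 2) // i ≠ j ∧ i ≠ k} => i.1)
        (fun i : {i : Fin (n + 2) // i ≠ j ∧ i ≠ k} => i.1)).det ≠ 0 := by
  rw [← block_injective_iff_det_ne_zero]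
  intro z hzj hzk hz
  -- all rows of `Hess z` vanish: rows `∉ {j,k}` by hypothesis, row `k` by the datum, row `j` by Euler + symmetry
  refine hD.eq_zero_of_hessianAt_mulVec_eq_zero hf₁ hzj hzk ?_
  have hrowk : (hessianAt f₁ (Pi.single j 1)).mulVec z k = 0 := by
    rw [Matrix.mulVec, dotProduct]
    refine Finset.sum_eq_zero fun i _ => ?_
    rw [hessianAt_comm, show hessianAt f₁ (Pi.single j 1) i k = eval (Pi.single j 1) (pderiv i (pderiv k f₁)) from rfl,
      hD.2.2.2.2.1 i, zero_mul]
  have hrowj : (hessianAt f₁ (Pi.single j 1)).mulVec z j = 0 := by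
    -- `Σ_i p_i (Hz)_i = Σ_i' z_i' (H p)_i' = 0` with `p = e_j`
    have hself := hessianAt_mulVec_self hf₁ hD.2.1
    have h1 : (hessianAt f₁ (Pi.single j 1)).mulVec z j =
        ∑ i', z i' * (hessianAt f₁ (Pi.single j 1)).mulVec (Pi.single j (1 : ℂ)) i' := by
      rw [Matrix.mulVec, dotProduct]
      refine Finset.sum_congr rfl fun i' _ => ?_
      rw [Matrix.mulVec, dotProduct, Finset.sum_eq_single j]
      · rw [Pi.single_eq_same, mul_one, hessianAt_comm, mul_comm]
      · intro i _ hi; rw [Pi.single_eq_of_ne hi, mul_zero]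
      · exact fun h => (h (Finset.mem_univ _)).elim
    rw [h1, hself]
    simp
  funext i
  by_cases hij : i = j
  · rw [hij, hrowj, Pi.zero_apply]
  · by_cases hik : i = k
    · rw [hik, hrowk, Pi.zero_apply]
    · rw [hz i hij hik, Pi.zero_apply]

end HodgeTheory

end Literature.AlgebraicGeometry.HodgeTheory

end
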